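import Summits.Parity.GeneralizedHardyLittlewood.Theses.PrimeLevelFamEdge
import Literature.NumberTheory.LFunctions.KowalskiMichelPeterssonBoundProof
import Literature.NumberTheory.LFunctions.KloostermanWeilPrimeProofs
import HarnessLib

/-!
# Route `PrimeLevelFamEdge` (rev 4), support `PeterssonBoundPrinted` (stmt-Parity-20404):
# the Petersson slot rests on Petersson's formula ALONE — Weil's bound is a theorem of the tree

The rev-4 Petersson slot of the route is the repaired harmonic-orthogonality estimate
`PeterssonBoundPrinted := KowalskiMichel2000.kowalskiMichel2000_peterssonBound`
(Kowalski–Michel 2000, p. 310 display with (23) in its range `q ∤ (m, n)`).  In print (p. 312) it is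
DEDUCED from two inputs: Petersson's formula `∑ʰ λ_f(l₁)λ_f(l₂) = δ(l₁,l₂) − J(l₁,l₂)` and Weil's
bound for Kloosterman sums; the tree proves that deduction as
`KowalskiMichel2000.peterssonBound_of_peterssonFormula : formula → Weil → bound` (p533420).  Weil's
bound (2.25) is itself a THEOREM of the tree (`Literature.NumberTheory.LFunctions.weil_kloosterman_bound_holds`,
`KloostermanWeilPrimeProofs.lean`, Stepanov–Schmidt), so the support item follows from ONE printed
fact, Petersson's trace formula at prime level and weight 2 as typed
(`KowalskiMichel2000.kowalskiMichel2000_peterssonFormula`):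

* `peterssonBoundPrinted_of_peterssonFormula : kowalskiMichel2000_peterssonFormula → PeterssonBoundPrinted`.

A CONDITIONAL result by design (the antecedent is an unproved printed identity; nothing here claims
the item outright).  «The programme SEARCHES and TYPES; no claim about Landau–Siegel zeros,
Theorems 1–2 of arXiv:2211.02515 or a repaired Margin232 until a kernel theorem says so.»
-/

namespace Summit.Parity.GeneralizedHardyLittlewood.Theorems

/-- **Support `PeterssonBoundPrinted` (stmt-Parity-20404) from Petersson's formula alone.**  The
route's rev-4 Petersson slot `KowalskiMichel2000.kowalskiMichel2000_peterssonBound` follows from the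
printed identity `kowalskiMichel2000_peterssonFormula` (Kowalski–Michel 2000, p. 312) by the tree's
proof of (23) (`peterssonBound_of_peterssonFormula`, p533420) with Weil's bound supplied by the
tree's theorem `weil_kloosterman_bound_holds` (Stepanov–Schmidt; no named fact). -/
theorem peterssonBoundPrinted_of_peterssonFormula
    (hF : Literature.NumberTheory.LFunctions.KowalskiMichel2000.kowalskiMichel2000_peterssonFormula) :
    Theses.PrimeLevelFamEdge.PeterssonBoundPrinted := by
  unfold Theses.PrimeLevelFamEdge.PeterssonBoundPrinted
  exact Literature.NumberTheory.LFunctions.KowalskiMichel2000.peterssonBound_of_peterssonFormula hF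
    Literature.NumberTheory.LFunctions.weil_kloosterman_bound_holds

end Summit.Parity.GeneralizedHardyLittlewood.Theorems
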